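import Summits.ABC.ABC.Theses.FeketeScales
import Literature.NumberTheory.DiophantineGeometry.AbcWave0QualityFormProofs
import HarnessLib

/-!
# Route FeketeScales — support item `PolynomialAbcOfSubmult` (stmt-ABC-2163)

**Scale sub-multiplicativity of the abc extremal height gives polynomial abc.** The route decl
`Summit.ABC.ABC.Theses.FeketeScales.PolynomialAbcOfSubmult` reads

> `ScaleSubmultiplicativity → finite_setOf_isABCTriple_primeFactors_subset →`
> `∃ A C : ℝ, ∀ a b c, IsABCTriple a b c → c ≤ C · rad(abc)^A`.

Proof (Fekete-type doubling, de Bruijn–Erdős / Fekete pattern with a summable error term).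
Let `(θ, K, R₀)` be the data of `ScaleSubmultiplicativity` (`θ < 1`, `K > 0`) and put
`R⋆ := max R₀ 2`, `t₀ := log R⋆ > 0`, `σ := 2^θ < 2`, `κ := σ / (2 - σ)`, `L := log (max K 1)`.
By abc.S25 (the hypothesis `finite_setOf_isABCTriple_primeFactors_subset`, applied to the primes
`≤ R⋆`: `rad(abc) ≤ R` puts every prime factor of `abc` below `R`) the triples of radical `≤ R⋆`
have `log c ≤ a₁` for some `a₁ ≥ 0`. With `α := a₁ + L + κ t₀^θ` one proves by induction on `i`

> every abc triple with `rad(abc) ≤ R⋆^(2^i)` has `log c ≤ 2^i α − L − κ (2^i t₀)^θ`: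

the step applies the crux at `R₁ = R₂ = R⋆^(2^i)` (slack `exp((2^{i+1} t₀)^θ) = exp(σ (2^i t₀)^θ)`)
and closes by the identity `(1 + κ) σ = 2 κ`. For a triple of radical `r` take `i` minimal with
`r ≤ R⋆^(2^i)`: either `i = 0` and `c ≤ e^α`, or `2^{i-1} t₀ < log r` and
`log c ≤ 2^i α ≤ (2α/t₀) log r`. Hence `c ≤ e^α · rad(abc)^{2α/t₀}` for every abc triple.

## References

* M. Fekete, *Über die Verteilung der Wurzeln bei gewissen algebraischen Gleichungen mit
  ganzzahligen Koeffizienten*, Math. Z. 17 (1923) (sub-additivity lemma); Mathlib `Subadditive`.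
* K. Mahler, *Zur Approximation algebraischer Zahlen I*, Math. Ann. 107 (1933) (abc.S25, used as
  the hypothesis `finite_setOf_isABCTriple_primeFactors_subset`). [Mahler1933]
* J.-H. Evertse, K. Győry, *Unit Equations in Diophantine Number Theory* (2015), Ch. 4, §4.6.
  [EvertseGyory2015]
-/

-- `Summit.<Summit>.<Problem>` is the mandated summit-side namespace (CONVENTIONS §2); for the
-- single-conjunct summit `ABC` the two coincide, so the duplicate `ABC.ABC` is deliberate.
set_option linter.dupNamespace false

noncomputable section

namespace Summit.ABC.ABC.Theorems

open Literature.NumberTheory.DiophantineGeometry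

/-- A bound `rad(abc) ≤ R` on the radical puts every prime factor of `abc` in `{0, …, R}`
(each prime factor of `n` divides, hence is at most, `radical n`). [folklore] -/
theorem feketeScales_primeFactors_subset_range_of_rad_le {a b c R : ℕ} (h : rad a b c ≤ R) :
    (a * b * c).primeFactors ⊆ Finset.range (R + 1) := by
  intro p hp
  rw [← Nat.primeFactors_radical] at hp
  have hle : p ≤ rad a b c := Nat.le_of_mem_primeFactors hp
  exact Finset.mem_range.mpr (by omega)

/-- abc.S25 (finiteness of abc triples with prescribed support), in the form used by the Fekete
iteration: for every scale `R` the abc triples of radical `≤ R` have bounded `c`. [folklore] -/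
theorem feketeScales_exists_bound_of_rad_le (hF : finite_setOf_isABCTriple_primeFactors_subset)
    (R : ℕ) : ∃ M : ℕ, ∀ a b c : ℕ, IsABCTriple a b c → rad a b c ≤ R → c ≤ M := by
  obtain ⟨M, hM⟩ := ((hF (Finset.range (R + 1))).image fun t : ℕ × ℕ × ℕ => t.2.2).bddAbove
  refine ⟨M, fun a b c ht hr => hM ?_⟩
  exact ⟨(a, b, c), ⟨ht, feketeScales_primeFactors_subset_range_of_rad_le hr⟩, rfl⟩

/-- **The doubling step of the Fekete iteration**, with abstract constants. If the G-free scale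
sub-multiplicativity holds with data `(θ, K, R₀)`, `R₀ ≤ R⋆`, `2 ≤ R⋆`, `σ = 2^θ`, `κ (2 - σ) = σ`,
`log K ≤ L`, `t₀ = log R⋆`, `α = a₁ + L + κ t₀^θ`, and every abc triple of radical `≤ R⋆` has
`log c ≤ a₁`, then every abc triple of radical `≤ R⋆^(2^i)` has
`log c ≤ 2^i α - L - κ (2^i t₀)^θ`. [folklore] -/
theorem feketeScales_log_le_of_doubling {θ K σ κ L α a₁ t₀ : ℝ} {R₀ Rs : ℕ} (hK : 0 < K)
    (hR₀ : R₀ ≤ Rs) (hRs : 2 ≤ Rs) (hσ : σ = (2 : ℝ) ^ θ) (hκ : κ * (2 - σ) = σ)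
    (hKL : Real.log K ≤ L) (ht₀ : t₀ = Real.log Rs) (hα : α = a₁ + L + κ * t₀ ^ θ)
    (hcrux : ∀ R₁ R₂ : ℕ, R₀ ≤ R₁ → R₀ ≤ R₂ → ∀ a b c : ℕ, IsABCTriple a b c →
      rad a b c ≤ R₁ * R₂ → ∃ a₁ b₁ c₁ a₂ b₂ c₂ : ℕ, IsABCTriple a₁ b₁ c₁ ∧ rad a₁ b₁ c₁ ≤ R₁ ∧
        IsABCTriple a₂ b₂ c₂ ∧ rad a₂ b₂ c₂ ≤ R₂ ∧
        (c : ℝ) ≤ K * Real.exp (Real.log ((R₁ : ℝ) * R₂) ^ θ) * c₁ * c₂)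
    (hbase : ∀ a b c : ℕ, IsABCTriple a b c → rad a b c ≤ Rs → Real.log c ≤ a₁) (i : ℕ) :
    ∀ a b c : ℕ, IsABCTriple a b c → rad a b c ≤ Rs ^ 2 ^ i →
      Real.log c ≤ 2 ^ i * α - L - κ * (2 ^ i * t₀) ^ θ := by
  induction i with
  | zero =>
    intro a b c ht hr
    rw [pow_zero, pow_one] at hr
    have h := hbase a b c ht hr
    rw [pow_zero, one_mul, one_mul, hα]
    linarith
  | succ i ih =>
    intro a b c ht hr
    have hRs0 : 0 < Rs := lt_of_lt_of_le two_pos hRs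
    have hR₁ : R₀ ≤ Rs ^ 2 ^ i := hR₀.trans (Nat.le_self_pow (pow_ne_zero i two_ne_zero) Rs)
    have hr' : rad a b c ≤ Rs ^ 2 ^ i * Rs ^ 2 ^ i := by
      rwa [← pow_add, ← two_mul, ← pow_succ'] 
    obtain ⟨a₁', b₁, c₁, a₂, b₂, c₂, ht₁, hr₁, ht₂, hr₂, hle⟩ := hcrux _ _ hR₁ hR₁ a b c ht hr'
    have h₁ := ih a₁' b₁ c₁ ht₁ hr₁
    have h₂ := ih a₂ b₂ c₂ ht₂ hr₂
    -- positivity of the c's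
    have hc : (0 : ℝ) < c := by exact_mod_cast lt_of_lt_of_le two_pos ht.two_le
    have hc₁ : (0 : ℝ) < c₁ := by exact_mod_cast lt_of_lt_of_le two_pos ht₁.two_le
    have hc₂ : (0 : ℝ) < c₂ := by exact_mod_cast lt_of_lt_of_le two_pos ht₂.two_le
    -- the slack exponent
    have ht₀nn : 0 ≤ t₀ := by
      rw [ht₀]; exact Real.log_nonneg (by exact_mod_cast hRs0)
    have hT : 0 ≤ 2 ^ i * t₀ := mul_nonneg (pow_nonneg zero_le_two i) ht₀nn
    have hne : ((Rs ^ 2 ^ i : ℕ) : ℝ) ≠ 0 := by positivity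
    have hlog2 : Real.log (((Rs ^ 2 ^ i : ℕ) : ℝ) * ((Rs ^ 2 ^ i : ℕ) : ℝ)) = 2 * (2 ^ i * t₀) := by
      rw [Real.log_mul hne hne]
      push_cast
      rw [Real.log_pow, ht₀]
      push_cast
      ring
    have hs : Real.log (((Rs ^ 2 ^ i : ℕ) : ℝ) * ((Rs ^ 2 ^ i : ℕ) : ℝ)) ^ θ = σ * (2 ^ i * t₀) ^ θ := by
      rw [hlog2, Real.mul_rpow zero_le_two hT, hσ]
    have hs' : ((2 : ℝ) ^ (i + 1) * t₀) ^ θ = σ * (2 ^ i * t₀) ^ θ := by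
      rw [pow_succ, mul_comm ((2 : ℝ) ^ i) 2, mul_assoc, Real.mul_rpow zero_le_two hT, hσ]
    -- take logarithms in the crux inequality
    have hlogle : Real.log c ≤ Real.log K + σ * (2 ^ i * t₀) ^ θ + Real.log c₁ + Real.log c₂ := by
      rw [← hs, Real.log_le_iff_le_exp hc, Real.exp_add, Real.exp_add, Real.exp_add, Real.exp_log hK,
        Real.exp_log hc₁, Real.exp_log hc₂]
      exact hle
    -- the key identity `(1 + κ) σ = 2 κ`, multiplied by `u := (2^i t₀)^θ`
    have key : σ * (2 ^ i * t₀) ^ θ - 2 * (κ * (2 ^ i * t₀) ^ θ) + κ * (σ * (2 ^ i * t₀) ^ θ) = 0 := by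
      linear_combination (-(2 ^ i * t₀) ^ θ) * hκ
    rw [hs', pow_succ]
    nlinarith [hlogle, h₁, h₂, hKL, key]

/-- **Polynomial abc from scale sub-multiplicativity** (route FeketeScales, support item
`PolynomialAbcOfSubmult`, stmt-ABC-2163): `ScaleSubmultiplicativity` together with abc.S25
(`finite_setOf_isABCTriple_primeFactors_subset`, a hypothesis) gives constants `A, C` with
`c ≤ C · rad(abc)^A` for every abc triple. Constants: `C = e^α`, `A = 2α / log R⋆` with
`R⋆ = max R₀ 2`, `α = a₁ + log (max K 1) + κ (log R⋆)^θ`, `κ = 2^θ / (2 - 2^θ)`. [folklore] -/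
theorem polynomialAbcOfSubmult_proof :
    Summit.ABC.ABC.Theses.FeketeScales.PolynomialAbcOfSubmult := by
  unfold Summit.ABC.ABC.Theses.FeketeScales.PolynomialAbcOfSubmult
    Summit.ABC.ABC.Theses.FeketeScales.ScaleSubmultiplicativity
  intro hS hF
  obtain ⟨θ, hθ, K, hK, R₀, hcrux⟩ := hS
  -- the base scale `Rs = max R₀ 2`
  obtain ⟨Rs, hRs_def⟩ : ∃ Rs : ℕ, Rs = max R₀ 2 := ⟨_, rfl⟩
  have hR₀ : R₀ ≤ Rs := hRs_def ▸ le_max_left _ _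
  have hRs : 2 ≤ Rs := hRs_def ▸ le_max_right _ _
  have hRs1 : (1 : ℝ) < Rs := by exact_mod_cast lt_of_lt_of_le one_lt_two hRs
  -- the constants
  obtain ⟨σ, hσ⟩ : ∃ σ : ℝ, σ = (2 : ℝ) ^ θ := ⟨_, rfl⟩
  have hσpos : 0 < σ := hσ ▸ Real.rpow_pos_of_pos two_pos θ
  have hσ2 : σ < 2 := by
    have h := Real.rpow_lt_rpow_of_exponent_lt (by norm_num : (1 : ℝ) < 2) hθ
    rwa [Real.rpow_one, ← hσ] at h
  obtain ⟨κ, hκ_def⟩ : ∃ κ : ℝ, κ = σ / (2 - σ) := ⟨_, rfl⟩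
  have hκ : κ * (2 - σ) = σ := by
    rw [hκ_def]
    exact div_mul_cancel₀ σ (sub_pos.mpr hσ2).ne'
  have hκnn : 0 ≤ κ := hκ_def ▸ div_nonneg hσpos.le (by linarith)
  obtain ⟨L, hL_def⟩ : ∃ L : ℝ, L = Real.log (max K 1) := ⟨_, rfl⟩
  have hKL : Real.log K ≤ L := hL_def ▸ Real.log_le_log hK (le_max_left _ _)
  have hL : 0 ≤ L := hL_def ▸ Real.log_nonneg (le_max_right _ _)
  obtain ⟨t₀, ht₀_def⟩ : ∃ t₀ : ℝ, t₀ = Real.log Rs := ⟨_, rfl⟩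
  have ht₀ : 0 < t₀ := ht₀_def ▸ Real.log_pos hRs1
  -- the base bound from abc.S25
  obtain ⟨M, hM⟩ := feketeScales_exists_bound_of_rad_le hF Rs
  obtain ⟨a₁, ha₁_def⟩ : ∃ a₁ : ℝ, a₁ = Real.log (max (M : ℝ) 1) := ⟨_, rfl⟩
  have ha₁ : 0 ≤ a₁ := ha₁_def ▸ Real.log_nonneg (le_max_right _ _)
  have hbase : ∀ a b c : ℕ, IsABCTriple a b c → rad a b c ≤ Rs → Real.log c ≤ a₁ := by
    intro a b c ht hr
    have hc : (0 : ℝ) < c := by exact_mod_cast lt_of_lt_of_le two_pos ht.two_le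
    rw [ha₁_def]
    exact Real.log_le_log hc (le_max_of_le_left (by exact_mod_cast hM a b c ht hr))
  obtain ⟨α, hα⟩ : ∃ α : ℝ, α = a₁ + L + κ * t₀ ^ θ := ⟨_, rfl⟩
  have hα0 : 0 ≤ α := by
    have : 0 ≤ κ * t₀ ^ θ := mul_nonneg hκnn (Real.rpow_nonneg ht₀.le θ)
    rw [hα]; linarith
  have main := feketeScales_log_le_of_doubling hK hR₀ hRs hσ hκ hKL ht₀_def hα hcrux hbase
  -- the constants `A = 2 α / t₀`, `C = e^α`
  refine ⟨2 * α / t₀, Real.exp α, fun a b c ht => ?_⟩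
  have hA : 0 ≤ 2 * α / t₀ := div_nonneg (by linarith) ht₀.le
  have hc : (0 : ℝ) < c := by exact_mod_cast lt_of_lt_of_le two_pos ht.two_le
  have hrad1 : (1 : ℝ) ≤ (rad a b c : ℝ) := by exact_mod_cast le_trans one_le_two ht.two_le_rad
  have hrad0 : (0 : ℝ) < (rad a b c : ℝ) := lt_of_lt_of_le one_pos hrad1
  have hC1 : (1 : ℝ) ≤ Real.exp α := Real.one_le_exp hα0
  have hpow1 : (1 : ℝ) ≤ ((rad a b c : ℕ) : ℝ) ^ (2 * α / t₀) := Real.one_le_rpow hrad1 hA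
  -- the minimal doubling scale above `rad(abc)`
  have hex : ∃ i : ℕ, rad a b c ≤ Rs ^ 2 ^ i := by
    refine ⟨rad a b c, ?_⟩
    calc rad a b c ≤ 2 ^ rad a b c := Nat.lt_two_pow_self.le
      _ ≤ 2 ^ 2 ^ rad a b c := Nat.pow_le_pow_right two_pos Nat.lt_two_pow_self.le
      _ ≤ Rs ^ 2 ^ rad a b c := Nat.pow_le_pow_left hRs _
  classical
  have hspec : rad a b c ≤ Rs ^ 2 ^ Nat.find hex := Nat.find_spec hex
  have hlogc := main (Nat.find hex) a b c ht hspec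
  have hlogc' : Real.log c ≤ 2 ^ Nat.find hex * α := by
    have : 0 ≤ κ * (2 ^ Nat.find hex * t₀) ^ θ :=
      mul_nonneg hκnn (Real.rpow_nonneg (mul_nonneg (pow_nonneg zero_le_two _) ht₀.le) θ)
    linarith
  rcases Nat.eq_zero_or_pos (Nat.find hex) with h0 | hpos
  · -- `rad ≤ R⋆`: `c ≤ e^α`
    rw [h0, pow_zero, one_mul, Real.log_le_iff_le_exp hc] at hlogc'
    calc (c : ℝ) ≤ Real.exp α := hlogc'
      _ = Real.exp α * 1 := (mul_one _).symm
      _ ≤ Real.exp α * ((rad a b c : ℕ) : ℝ) ^ (2 * α / t₀) :=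
          mul_le_mul_of_nonneg_left hpow1 (Real.exp_pos α).le
  · -- `R⋆^(2^j) < rad ≤ R⋆^(2^(j+1))`: `log c ≤ 2 · 2^j α ≤ (2α/t₀) log rad`
    obtain ⟨j, hj⟩ : ∃ j : ℕ, Nat.find hex = j + 1 := ⟨Nat.find hex - 1, by omega⟩
    have hnot : ¬ rad a b c ≤ Rs ^ 2 ^ j := Nat.find_min hex (by omega)
    have hlt : ((Rs ^ 2 ^ j : ℕ) : ℝ) < rad a b c := by exact_mod_cast not_le.mp hnot
    have hlt' : (2 : ℝ) ^ j * t₀ < Real.log (rad a b c) := by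
      have h := Real.log_lt_log (by positivity) hlt
      push_cast at h
      rw [Real.log_pow] at h
      push_cast at h
      rw [ht₀_def]
      linarith
    rw [hj, pow_succ] at hlogc'
    have hlogA : Real.log c ≤ 2 * α / t₀ * Real.log (rad a b c) := by
      rw [div_mul_eq_mul_div, le_div_iff₀ ht₀]
      have h2j : 0 ≤ (2 : ℝ) ^ j := pow_nonneg zero_le_two j
      nlinarith [hlogc', hlt', hα0, ht₀, h2j, mul_nonneg hα0 h2j]
    rw [Real.log_le_iff_le_exp hc] at hlogA
    calc (c : ℝ) ≤ Real.exp (2 * α / t₀ * Real.log (rad a b c)) := hlogA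
      _ = ((rad a b c : ℕ) : ℝ) ^ (2 * α / t₀) := by
          rw [Real.rpow_def_of_pos hrad0, mul_comm]
      _ = 1 * ((rad a b c : ℕ) : ℝ) ^ (2 * α / t₀) := (one_mul _).symm
      _ ≤ Real.exp α * ((rad a b c : ℕ) : ℝ) ^ (2 * α / t₀) :=
          mul_le_mul_of_nonneg_right hC1 (le_trans zero_le_one hpow1)

end Summit.ABC.ABC.Theorems

end
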